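import Summits.ResolutionOfSingularities.ResolutionOfSingularities.Theorems.StallVertexCompanion4
import HarnessLib

/-!
# StallVertexCompanion5 — decomp-res node «StallVertexCompanion (lens-5 g29, rev 10 of the node «StallVertex»;
critic row 192 CLEARED +1)», tree file 5/8 of the node

Content from the decomp-res lens-5 g29 node file `HOME/decomp-res-lens-5/g29/StallVertexCompanion.lean` (pin
deaa8fea) with the critic's ten mechanical lint fixes (fixed sha256 245dae5b; HOME =
run/shared/lean/pub/decomp-res); critic CRITIC-LEDGER row 192 CLEARED +1 — provenance, the fix list, critic text and
the lens header in full in part 2 of the node, `StallVertexCompanion`.  Namespace `…Theorems.StallVertex`;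
`--supports stmt-ResolutionOfSingularities-31770`.

## This file

Continuation 5/8 of `StallVertexCompanion` (same namespace and sections of the node, cut at the tree's 400-line cap;
section variables / opens replayed): `section Walk`, `section WalkTangent` — carries `nondefAt_of_kept`,
`minimiser_succ`, `flat_law`, `companion_level`, `youngExp`, `youngExp_apply`, `TangentAt`, `levelRatio_natCast_inj`.

[WRITER NOTE (decomp-res writer g12): file split only (tree files ≤ 400 lines) plus the ten critic-ordered lint
fixes listed in `StallVertexCompanion`; namespace, sections, section variables / opens / `set_option maxHeartbeats …
in` lines and every declaration otherwise exactly as in the lens.]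

(Sources: KawanoueMatsuki2012 arXiv:1205.4556 Prop. 3 (the companion (c_{f,𝕆}·𝕄^{-a}, μ̃·a)); Moh1987; Hauser2010
(kangaroo points); HauserPerlega2019 §2; HauserPerlega2024; CossartPiltant2008 §2; CossartJannsenSaito2020 Ch. 8;
Benito–Villamayor (monomial case); Hironaka2005.)
-/

noncomputable section

open MvPolynomial Finset
open Literature.AlgebraicGeometry.Resolution
open Literature.AlgebraicGeometry.Resolution.Hauser2010
open Literature.AlgebraicGeometry.Resolution.HauserPerlega2024
open Literature.Barriers.ResolutionOfSingularities
open Literature.AlgebraicGeometry.Resolution.PointBlowup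
open Summit.ResolutionOfSingularities.ResolutionOfSingularities.Theses
open Summit.ResolutionOfSingularities.ResolutionOfSingularities.Theorems.TightDefectClasses
open Summit.ResolutionOfSingularities.ResolutionOfSingularities.Theorems.ProximityCut
open Summit.ResolutionOfSingularities.ResolutionOfSingularities.Theorems.ExitLaw
open Summit.ResolutionOfSingularities.ResolutionOfSingularities.Theorems.DifferentialShade

namespace Summit.ResolutionOfSingularities.ResolutionOfSingularities.Theorems.StallVertex

section Walk

variable {K : Type} [Field K] [DecidableEq K]

/-- **(D2′) KEPT: non-deficiency PROPAGATES BACKWARDS through a kept move** — the mass is constant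
(`stall_ledger` (6)), the divisor order can only grow (`divisorOrder_le_divisorOrder_kept`), and the mass never exceeds
the attained ratio. [new] [folklore] -/
theorem nondefAt_of_kept {p e : ℕ} (hp : p.Prime) [CharP K p] {s₀ : State (Fin 3) K} (hs : IsRoot (p ^ e) s₀)
    (W : ForcedWalk (p ^ e) s₀) (t : ℕ)
    (hst : (ifp W (t + 1)).muTilde (p ^ e) = (ifp W t).muTilde (p ^ e))
    {J₀ : Fin 3 →₀ ℕ} (hJ₀ : J₀ ∈ (ifp W t).idx)
    (hμ : (ifp W t).muP (p ^ e) = levelRatio (ordZero ((ifp W t).gen J₀)) (p ^ e - J₀.degree))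
    {i : Fin 3} (hi : i ∈ (ifp W t).young) (hij : i ≠ W.j t) (hbi : W.b t i = 0)
    (h : NondefAt W (t + 1) J₀ i) : NondefAt W t J₀ i := by
  obtain ⟨d₀, hd₀⟩ := exists_ordZero_eq_natCast (gen_ne_zero_of_minimiser hp hs W t hμ)
  have h6 := (stall_ledger (p ^ e) (W.j t) (W.b t) (W.onExc t) (ifp W t) (fun J hJ => (level_bounds W t J hJ).2)
    (sing_ifp hp hs W t) (by rw [← ifp_succ]; exact hst.symm.le) hJ₀ hμ hd₀).1 i hi hij hbi
  rw [← ifp_succ] at h6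
  unfold NondefAt at h ⊢
  have hgen : (ifp W (t + 1)).gen J₀ =
      PointBlowup.translate (W.b t) (chartTransform (p ^ e - J₀.degree) (W.j t) ((ifp W t).gen J₀)) := by
    rw [ifp_succ]; rfl
  apply le_antisymm (Finset.inf_le hJ₀)
  calc levelRatio (divisorOrder i ((ifp W t).gen J₀)) (p ^ e - J₀.degree)
      ≤ levelRatio (divisorOrder i ((ifp W (t + 1)).gen J₀)) (p ^ e - J₀.degree) := by
        rw [hgen]; exact levelRatio_mono (divisorOrder_le_divisorOrder_kept (W.b t) hij hbi _ _) _
    _ = (ifp W t).muPD (p ^ e) i := by rw [← h, h6]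

/-- Persistence of a minimiser through a stalled move (`stall_rigid` (3)) along the walk. [folklore] -/
theorem minimiser_succ {p e : ℕ} (hp : p.Prime) [CharP K p] {s₀ : State (Fin 3) K} (hs : IsRoot (p ^ e) s₀)
    (W : ForcedWalk (p ^ e) s₀) (t : ℕ)
    (hst : (ifp W (t + 1)).muTilde (p ^ e) = (ifp W t).muTilde (p ^ e))
    {J₀ : Fin 3 →₀ ℕ} (hJ₀ : J₀ ∈ (ifp W t).idx)
    (hμ : (ifp W t).muP (p ^ e) = levelRatio (ordZero ((ifp W t).gen J₀)) (p ^ e - J₀.degree)) :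
    J₀ ∈ (ifp W (t + 1)).idx ∧
      (ifp W (t + 1)).muP (p ^ e) = levelRatio (ordZero ((ifp W (t + 1)).gen J₀)) (p ^ e - J₀.degree) := by
  obtain ⟨d₀, hd₀⟩ := exists_ordZero_eq_natCast (gen_ne_zero_of_minimiser hp hs W t hμ)
  have hrig := stall_rigid (p ^ e) (W.j t) (W.b t) (W.onExc t) (ifp W t) (fun J hJ => (level_bounds W t J hJ).2)
    (sing_ifp hp hs W t) (by rw [← ifp_succ]; exact hst.symm.le) hJ₀ hμ hd₀
  refine ⟨by rw [idx_ifp] at hJ₀ ⊢; exact hJ₀, ?_⟩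
  rw [ifp_succ]; exact hrig.2.2.1

/-- **THE FLAT LAW.**  On a stalled stretch `t ≥ N` of a root walk on which every letter is charted or translated again
and again (the SKEW binder), EVERY young letter of EVERY `μ_P`-minimiser is NON-DEFICIENT at every `t ≥ N`:
`μ_{P,D_i}(t) = ord_{u_i}(g_{J₀}(t)) / a₀`.  (Follow the letter to the first move `s ≥ t` that charts or translates it:
it is kept — with constant mass, `stall_ledger` (6) — until `s`, lost at `s`, hence non-deficient at `s` by
`stall_ledger` (7); non-deficiency propagates back through the kept moves, `nondefAt_of_kept`.)  The young monomial
`∏_young u_i^{ord_{u_i} g_{J₀}}` is Kawanoue–Matsuki's `Mon(ℛ)^{a₀}` EXACTLY, on every skew stalled tail and for a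
general cone — rev 7's `eventually_flat` without the monomial-regime hypothesis. (Sources: KawanoueMatsuki2016 §4.1,
§5.3; arXiv:1205.4556 Proposition 3; new as a walk law.) -/
theorem flat_law {p e : ℕ} (hp : p.Prime) [CharP K p] {s₀ : State (Fin 3) K} (hs : IsRoot (p ^ e) s₀)
    (W : ForcedWalk (p ^ e) s₀) (N : ℕ)
    (hstall : ∀ t, N ≤ t → (ifp W (t + 1)).muTilde (p ^ e) = (ifp W t).muTilde (p ^ e))
    (hskew : ∀ (k : Fin 3) (N' : ℕ), ∃ t, N' ≤ t ∧ (W.j t = k ∨ W.b t k ≠ 0)) :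
    ∀ t, N ≤ t → ∀ J₀ ∈ (ifp W t).idx,
      (ifp W t).muP (p ^ e) = levelRatio (ordZero ((ifp W t).gen J₀)) (p ^ e - J₀.degree) →
      ∀ i ∈ (ifp W t).young, NondefAt W t J₀ i := by
  classical
  have key : ∀ n t, N ≤ t → ∀ J₀ ∈ (ifp W t).idx,
      (ifp W t).muP (p ^ e) = levelRatio (ordZero ((ifp W t).gen J₀)) (p ^ e - J₀.degree) →
      ∀ i ∈ (ifp W t).young, (∀ m, m < n → W.j (t + m) ≠ i ∧ W.b (t + m) i = 0) →
      (W.j (t + n) = i ∨ W.b (t + n) i ≠ 0) → NondefAt W t J₀ i := by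
    intro n
    induction n with
    | zero =>
      intro t ht J₀ hJ₀ hμ i hi _ hl
      rw [Nat.add_zero] at hl
      exact nondefAt_of_lost hp hs W t (hstall t ht) hJ₀ hμ hi (hl.imp Eq.symm id)
    | succ n ih =>
      intro t ht J₀ hJ₀ hμ i hi hkept hl
      obtain ⟨hij, hbi⟩ := hkept 0 (Nat.succ_pos n)
      rw [Nat.add_zero] at hij hbi
      obtain ⟨hJ₀', hμ'⟩ := minimiser_succ hp hs W t (hstall t ht) hJ₀ hμ
      have hi' : i ∈ (ifp W (t + 1)).young := by
        rw [ifp_succ]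
        show i ∈ insert (W.j t) ((ifp W t).young.filter fun k => W.b t k = 0)
        exact Finset.mem_insert_of_mem (Finset.mem_filter.mpr ⟨hi, hbi⟩)
      have h' := ih (t + 1) (by omega) J₀ hJ₀' hμ' i hi'
        (fun m hm => by
          have := hkept (m + 1) (by omega)
          rwa [show t + (m + 1) = t + 1 + m by omega] at this)
        (by rwa [show t + (n + 1) = t + 1 + n by omega] at hl)
      exact nondefAt_of_kept hp hs W t (hstall t ht) hJ₀ hμ hi (Ne.symm hij) hbi h'
  intro t ht J₀ hJ₀ hμ i hi
  obtain ⟨s, hts, hact⟩ := hskew i t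
  have hex : ∃ n, W.j (t + n) = i ∨ W.b (t + n) i ≠ 0 := ⟨s - t, by rwa [Nat.add_sub_cancel' hts]⟩
  refine key (Nat.find hex) t ht J₀ hJ₀ hμ i hi (fun m hm => ?_) (Nat.find_spec hex)
  have h := Nat.find_min hex hm
  push Not at h
  exact ⟨h.1, h.2⟩

/-- **THE COMPANION LEVEL IS AN INTEGER.**  On a skew stalled tail, at every `t ≥ N` and for every minimiser `J₀`
(order `d₀`, level `a₀`): `μ̃(t) = (d₀ − Σ_young ord_{u_i} g_{J₀}(t)) / a₀` — `a₀·μ̃` is the INTEGER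
`w := d₀ − |𝕄^{a₀}|`, the order of Kawanoue–Matsuki's companion `c_t = g_{J₀} / 𝕄^{a₀}` (`𝕄^{a₀} =
∏_young u_i^{ord_{u_i} g_{J₀}}` divides `g_{J₀}` by definition of the divisor orders).  On the positive leaf `w ≥ 1`.
(Sources: arXiv:1205.4556 Proposition 3 (the element `(c_{f,𝕆}·𝕄^{-a}, μ̃·a)`); new as a walk law.) -/
theorem companion_level {p e : ℕ} (hp : p.Prime) [CharP K p] {s₀ : State (Fin 3) K} (hs : IsRoot (p ^ e) s₀)
    (W : ForcedWalk (p ^ e) s₀) (N : ℕ)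
    (hstall : ∀ t, N ≤ t → (ifp W (t + 1)).muTilde (p ^ e) = (ifp W t).muTilde (p ^ e))
    (hskew : ∀ (k : Fin 3) (N' : ℕ), ∃ t, N' ≤ t ∧ (W.j t = k ∨ W.b t k ≠ 0))
    {t : ℕ} (ht : N ≤ t) {J₀ : Fin 3 →₀ ℕ} (hJ₀ : J₀ ∈ (ifp W t).idx)
    (hμ : (ifp W t).muP (p ^ e) = levelRatio (ordZero ((ifp W t).gen J₀)) (p ^ e - J₀.degree))
    {d₀ : ℕ} (hd₀ : ordZero ((ifp W t).gen J₀) = d₀) :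
    (ifp W t).muTilde (p ^ e) =
      ((((d₀ : ℚ) - ∑ i ∈ (ifp W t).young, ((divisorOrder i ((ifp W t).gen J₀)).toNat : ℚ)) /
        (p ^ e - J₀.degree : ℕ) : ℚ) : WithTop ℚ) := by
  classical
  have hg₀ne := gen_ne_zero_of_minimiser hp hs W t hμ
  rw [muTilde_eq_at (p ^ e) (ifp W t) hμ hd₀]
  have hsum : ∑ i ∈ (ifp W t).young, ((ifp W t).muPD (p ^ e) i).untopD 0 =
      ∑ i ∈ (ifp W t).young, ((divisorOrder i ((ifp W t).gen J₀)).toNat : ℚ) / (p ^ e - J₀.degree : ℕ) := by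
    refine Finset.sum_congr rfl fun i hi => ?_
    have h := flat_law hp hs W N hstall hskew t ht J₀ hJ₀ hμ i hi
    unfold NondefAt at h
    rw [← ENat.coe_toNat (divisorOrder_ne_top (i := i) hg₀ne), levelRatio_natCast] at h
    rw [h, WithTop.untopD_coe]
  rw [hsum, ← Finset.sum_div, ← sub_div]

end Walk

section WalkTangent

variable {K : Type} [Field K] [DecidableEq K]

/-! ### §2f (rev 10, generation 29) THE TANGENT CONE OF THE COMPANION: tangency is never regained -/

/-- The YOUNG EXPONENT of the minimiser `J₀` at time `t`: `B(t) = Σ_{young} ord_{u_i}(g_{J₀}) · 1_i` — by the flat law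
this is Kawanoue–Matsuki's boundary exponent `(a₀ μ_{P,D_i})_i`; `u^{B(t)} = 𝕄^{a₀}`. [new object] -/
def youngExp {q : ℕ} {s₀ : State (Fin 3) K} (W : ForcedWalk q s₀) (t : ℕ) (J₀ : Fin 3 →₀ ℕ) : Fin 3 →₀ ℕ :=
  ∑ i ∈ (ifp W t).young, Finsupp.single i (divisorOrder i ((ifp W t).gen J₀)).toNat

/-- `youngExp_apply`: Auxiliary step of this node's calculus, VERBATIM from the lens file (see the module
docstring); the statement is its type. [folklore] -/
theorem youngExp_apply {q : ℕ} {s₀ : State (Fin 3) K} (W : ForcedWalk q s₀) (t : ℕ) (J₀ : Fin 3 →₀ ℕ) (i : Fin 3) :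
    youngExp W t J₀ i = if i ∈ (ifp W t).young then (divisorOrder i ((ifp W t).gen J₀)).toNat else 0 := by
  classical
  unfold youngExp
  rw [Finsupp.coe_finsetSum, Finset.sum_apply]
  simp_rw [Finsupp.single_apply]
  exact Finset.sum_ite_eq' _ i _

/-- **TANGENT** at time `t` for the minimiser `J₀`: the initial form of the carried derivative is the young (boundary)
monomial times a PURE `w`-th POWER, `w ≥ 1`, of ONE linear form `ℓ_t` THROUGH THE DIRECTION `b_t[j_t ↦ 1]` of move `t`:
`in(g_{J₀}(t)) = r · u^{B(t)} · ℓ_t^w` — the companion `c_t = g_{J₀}/𝕄^{a₀}` has tangent cone `ℓ_t^{a₀μ̃}`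
(Kawanoue–Matsuki's unit-2 LGS element, read at cone level). [new object] -/
def TangentAt {q : ℕ} {s₀ : State (Fin 3) K} (W : ForcedWalk q s₀) (t : ℕ) (J₀ : Fin 3 →₀ ℕ) : Prop :=
  ∃ (r : K) (c : Fin 3 → K) (w : ℕ), r ≠ 0 ∧ 0 < w ∧
    ordZero ((ifp W t).gen J₀) = (((youngExp W t J₀).degree + w : ℕ) : ℕ∞) ∧
    homogeneousComponent ((youngExp W t J₀).degree + w) ((ifp W t).gen J₀) =
      monomial (youngExp W t J₀) r * (∑ i, C (c i) * X i) ^ w ∧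
    ∑ i, c i * Function.update (W.b t) (W.j t) 1 i = 0

/-- Injectivity of `levelRatio · a` on naturals for a positive level. [folklore] -/
theorem levelRatio_natCast_inj {n n' a : ℕ} (ha : 0 < a)
    (h : levelRatio (n : ℕ∞) a = levelRatio (n' : ℕ∞) a) : n = n' := by
  rw [levelRatio_natCast, levelRatio_natCast, WithTop.coe_eq_coe] at h
  have ha' : (a : ℚ) ≠ 0 := by exact_mod_cast ha.ne'
  rw [div_left_inj' ha'] at h
  exact_mod_cast h

end WalkTangent

end Summit.ResolutionOfSingularities.ResolutionOfSingularities.Theorems.StallVertex
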